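import Literature.IUT.HodgeArakelov.FlTorsorDihedralToy
import Literature.IUT.HodgeArakelov.FlTorsorConjActFaithful

/-!
# [IUTchII] Def 2.3 (v), a TYPING PROBE: in the dihedral `𝔽_l^{⋊±}`-torsor toy the interface field `conjAct` can NOT
# be the conjugation action on cuspidal inertia subgroups

S. Mochizuki, *Inter-universal Teichmüller theory II*, kurims manuscript (Dec. 2020), §2 Def 2.3 (v) p. 69: «the
natural action of `Π_⊇/Π_⊆` on `Π_⊆` preserves this `𝔽^±_l`-torsor structure, hence determines a natural outer
isomorphism `Π_⊇/Π_⊆ ≅ 𝔽_l^{⋊±}`» [claim: Mochizuki2012, status: disputed] (IUTchII §2 Def 2.3 (v), kurims p.69)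
(D-0012 claim key; nothing printed is asserted here).

PROOF-ONLY file (abc-iut cell, seat abc-iut-w5-d243 gen 3; no `def`, no instance, no named fact).  On the landed
dihedral `𝔽_l^{⋊±}`-torsor toy (`FlTorsorDihedralToy.lean`, p427711; `Π̂^cor_v = D_{3^l} × (ℤ/l × D_l)`, cusps `K_{3^t} × 1`,
`FlTorsorStructure` INHABITED) the element `g₀ := (1, (1, r))` lies OUTSIDE `Π̂^±_v` yet CENTRALISES `D_{3^l} × 1 ⊇` every
cuspidal inertia subgroup (`conj_cusp_eq_of_fst_eq_one`); by the interface theorem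
`FlTorsorStructure.forall_conjAct_eq_self_iff` (`FlTorsorConjActFaithful.lean`: the kernel of the label action is
exactly `Π̂^±_v`) every inhabitant `F` moves some label under `F.conjAct g₀` although conjugation by `g₀` fixes every
cusp: **`not_exists_conjAct_eq_conj`** — NO `F : FlTorsorStructure C` on the toy satisfies `F.conjAct g ⟦I⟧ = ⟦g I g⁻¹⟧`
(even restricted to the pairs `(g, I)` for which `g I g⁻¹` is again a declared cusp), with a closed instance.  READING (a
typing observation, not a claim about print; it sharpens the reading note of `FlTorsorStructureNonVacuity.lean` p419621
into a kernel counter-model): the interface field `FlTorsorStructure.conjAct` is constrained ONLY through the chart law;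
the wanted laws `conj_stable` + `conjAct_spec` are GAP-LEDGER row G-w5d243-1 (satisfiable: `FlTorsorWreathToy.lean`).
Nothing here bears on [IUTchIII] Cor. 3.12; typed ≠ proved; no side taken.
-/

noncomputable section

namespace Literature.IUT.HodgeArakelov

/-! ## (B) The typing probe on the dihedral `𝔽_l^{⋊±}`-torsor toy -/

namespace FlTorsorToy

open DihedralGroup DihedralCuspToy Literature.IUT.HodgeTheaters

variable (l p : ℕ) (hl : l.Prime) (hl2 : l ≠ 2) (hp : p.Prime) (hp2 : p ≠ 2) (hpl : p ≠ l)

/-- In `Π̂^cor_v = D_m × (ℤ/l × D_l)`, an element with trivial first component commutes with `D_m × 1`.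
[claim: Mochizuki2012, status: disputed] (IUTchII §2 Def 2.3 (v), kurims p.69) -/
theorem conj_eq_self_of_fst_eq_one {a y : Cor2 l} (ha : a.1 = 1) (hy : y.2 = 1) : a * y * a⁻¹ = y := by
  ext <;> simp [ha, hy]

/-- Such an element fixes every cuspidal inertia subgroup `K_{3^t} × 1` under conjugation.
[claim: Mochizuki2012, status: disputed] (IUTchII §2 Def 2.3 (v), kurims p.69) -/
theorem conj_cusp_eq_of_fst_eq_one {a : Cor2 l} (ha : a.1 = 1) (t : ZMod l) :
    (cusp l t).map (MulAut.conj a).toMonoidHom = cusp l t := by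
  have key : ∀ y ∈ cusp l t, a * y * a⁻¹ = y := fun y hy =>
    conj_eq_self_of_fst_eq_one l ha ((Subgroup.mem_bot).mp (Subgroup.mem_prod.mp hy).2)
  ext y
  constructor
  · rintro ⟨z, hz, rfl⟩
    rw [MulEquiv.coe_toMonoidHom, MulAut.conj_apply, key z hz]
    exact hz
  · intro hy
    exact ⟨y, hy, by rw [MulEquiv.coe_toMonoidHom, MulAut.conj_apply, key y hy]⟩

/-- The probe element `g₀ := (1, (1, r)) ∈ Π̂^cor_v` lies OUTSIDE `Π̂^±_v = D_m × (ℤ/l × 1)` (for `l ≥ 2`).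
[claim: Mochizuki2012, status: disputed] (IUTchII §2 Def 2.3 (v), kurims p.69) -/
theorem probe_not_mem_pmHat :
    ((1 : Dm l), ((1 : Multiplicative (ZMod l)), r (1 : ZMod l))) ∉ (fTower l p hl hl2 hp hp2 hpl).pmHat := by
  haveI : Fact (1 < l) := ⟨hl.one_lt⟩
  rw [mem_pmHat_iff, Hl, Subgroup.mem_prod, Subgroup.mem_bot]
  rintro ⟨-, h⟩
  rw [← r_zero] at h
  exact one_ne_zero (r.inj h)

/-- **TYPING PROBE** ([IUTchII] Def 2.3 (v), kurims p. 69 «the natural action of `Π_⊇/Π_⊆` on `Π_⊆` preserves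
this `𝔽^±_l`-torsor structure»): on the dihedral `𝔽_l^{⋊±}`-torsor toy (where `FlTorsorStructure` IS inhabited,
`FlTorsorToy.nonempty_flTorsorStructure`) there is NO inhabitant whose action field `conjAct` agrees with
CONJUGATION of cuspidal inertia subgroups — not even on the pairs `(g, I)` for which `g I g⁻¹` is again a
declared cusp: the probe `g₀ ∉ Π̂^±_v` centralises every cusp, but by (A) it must move some label.  I.e. the
typed interface does not tie `conjAct` to conjugation (reading note of p419621, made a kernel counter-model).
[claim: Mochizuki2012, status: disputed] (IUTchII §2 Def 2.3 (v), kurims p.69) -/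
theorem not_exists_conjAct_eq_conj :
    ¬ ∃ F : FlTorsorStructure (fCusps l p hl hl2 hp hp2 hpl),
        ∀ (g : (fTower l p hl hl2 hp hp2 hpl).Corhat) (I : Subgroup (fTower l p hl hl2 hp hp2 hpl).Corhat)
          (hI : (fCusps l p hl hl2 hp hp2 hpl).IsCuspidalInertia (fTower l p hl hl2 hp hp2 hpl).pmHat I)
          (hgI : (fCusps l p hl hl2 hp hp2 hpl).IsCuspidalInertia (fTower l p hl hl2 hp hp2 hpl).pmHat
            (I.map (MulAut.conj g).toMonoidHom)),
          F.conjAct g (Quot.mk _ ⟨I, hI⟩) = Quot.mk _ ⟨I.map (MulAut.conj g).toMonoidHom, hgI⟩ := by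
  rintro ⟨F, hF⟩
  set g₀ : Cor2 l := ((1 : Dm l), ((1 : Multiplicative (ZMod l)), r (1 : ZMod l))) with hg₀
  refine probe_not_mem_pmHat l p hl hl2 hp hp2 hpl ((F.forall_conjAct_eq_self_iff g₀).mp fun t => ?_)
  induction t using Quot.ind with
  | mk I =>
    obtain ⟨I, hle, s, rfl⟩ := I
    have e : (cusp l s).map (MulAut.conj g₀).toMonoidHom = cusp l s := conj_cusp_eq_of_fst_eq_one l rfl s
    have hgI : (fCusps l p hl hl2 hp hp2 hpl).IsCuspidalInertia (fTower l p hl hl2 hp hp2 hpl).pmHat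
        ((cusp l s).map (MulAut.conj g₀).toMonoidHom) := by
      rw [e]; exact ⟨hle, s, rfl⟩
    rw [hF g₀ (cusp l s) ⟨hle, s, rfl⟩ hgI]
    exact congrArg (Quot.mk _) (Subtype.ext e)

/-- **Closed instance of the probe** (`l := 3`, `p := 5`): there exist, in the kernel, `(S, T, W, C)` with
`FlTorsorStructure C` INHABITED and yet NO inhabitant whose `conjAct` is conjugation on cusps.
[claim: Mochizuki2012, status: disputed] (IUTchII §2 Def 2.3 (v), kurims p.69) -/
theorem exists_inhabited_without_conjugation_action :
    ∃ (S : BadPlaceSetting.{0}) (T : TemperedCoverings S S.PiX) (W : PlusMinusTower T) (C : CuspidalInertiaData W),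
      Nonempty (FlTorsorStructure C) ∧
      ¬ ∃ F : FlTorsorStructure C, ∀ (g : W.Corhat) (I : Subgroup W.Corhat)
          (hI : C.IsCuspidalInertia W.pmHat I) (hgI : C.IsCuspidalInertia W.pmHat (I.map (MulAut.conj g).toMonoidHom)),
          F.conjAct g (Quot.mk _ ⟨I, hI⟩) = Quot.mk _ ⟨I.map (MulAut.conj g).toMonoidHom, hgI⟩ :=
  ⟨_, _, _, _, nonempty_flTorsorStructure 3 5 Nat.prime_three (by decide) Nat.prime_five (by decide) (by decide),
    not_exists_conjAct_eq_conj 3 5 Nat.prime_three (by decide) Nat.prime_five (by decide) (by decide)⟩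

end FlTorsorToy

end Literature.IUT.HodgeArakelov

end
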